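import Summits.AtomisticToContinuum.BoseEinsteinCondensation.Theorems.BECInfDivCoherenceLevyNegativeMomentTargetStrengthBounded
import Summits.AtomisticToContinuum.BoseEinsteinCondensation.Theorems.BECInfDivCoherenceGridInfDivCoherenceCoherencePosIntegrable
import Summits.AtomisticToContinuum.BoseEinsteinCondensation.Theorems.BECInfDivCoherenceGridInfDivCoherenceCoherencePosNonintegrable
import HarnessLib

/-!
# Crux `LevyNegativeMoment` (stmt-AtomisticToContinuum-9115) — the crux is target-strength beyond the
# bounded sector: integrable and locally bounded profiles unconditionally, hard cores modulo Lemma G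
# (route `BECInfDivCoherence`, line `registered`, lead cycle 4; supports, does not close, the crux)

Sequel of `…LevyNegativeMomentTargetStrengthBounded.lean` (lead c3: the crux ALONE implies the `PeriodicBEC`
clause of every BOUNDED admissible `v`).  The only input of that certificate which depended on boundedness
was positivity of the translation coherence of near-minimisers; the sister line (crux `GridInfDivCoherence`,
stmt-9114) has since proved that positivity for much larger classes, and this file threads those results
through c3's localised certificate `periodicBEC_clause_of_gridMeanLog_of_coherencePos`:

* `periodicBEC_clause_of_levyNegativeMoment_of_coherencePos_clause` — per potential: crux + positivity
  clause at `v` ⟹ `PeriodicBEC` clause at `v` (plumbing; any future positivity theorem plugs in here);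
  `periodicBEC_clause_of_logClusterL1_of_coherencePos_clause` — the same for the registered stub.
* `periodicBEC_clause_of_levyNegativeMoment_integrable` — **unconditional for every INTEGRABLE admissible
  profile** (`∫_{ℝ³} v(|x|) dx < ∞`; positivity = `stub_coherencePos_integrable`, 9114 lead).
* `periodicBEC_clause_of_levyNegativeMoment_locallyBounded` — **unconditional for every admissible profile
  locally bounded on `(0,∞)`** (finite away from the origin: all bounded and all soft, possibly non-integrable,
  cores; positivity = `CoherencePosHC.coherencePos_of_locallyBounded`, Faris–Simon).
* `periodicBEC_clause_of_levyNegativeMoment_hardCore_of_lemmaG` — for genuine hard cores (`v = ⊤` on `[0,a)`,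
  bounded tail) MODULO Lemma G (dilute hard-sphere connectivity on the torus, hypothesis `hG` verbatim the
  9114 line's registered `stub_lemmaGConnected`; positivity = `CoherencePosHC.coherencePos_of_hardCore`).
* the stub analogues `periodicBEC_clause_of_logClusterL1_integrable / _locallyBounded`, and with the route's
  own `BoundaryTransferWeak` (stmt-0827) the conjunct's criterion `HasGroundStateBEC v ρ` at all small `ρ` on
  the integrable and locally bounded classes (`hasGroundStateBEC_…`), the sister crux being idle there.

Reading for the route: any proof of the crux (or of `stub_logClusterL1`) contains Bose–Einstein condensation
of the dilute gas in the thermodynamic limit for every soft potential, and for hard spheres modulo Lemma G —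
the crux dominates the sub-problem target (closed-as-moot item stmt-0826) on everything but the exotic
`⊤`-class.  No claim is made about the truth of the crux.
-/

noncomputable section

namespace Summit.AtomisticToContinuum.BoseEinsteinCondensation.Theorems

open MeasureTheory Filter Literature.MathematicalPhysics.QuantumManyBody.BoseGas InfDivGlue
open scoped ENNReal NNReal ComplexConjugate

/-! ### Plumbing at one potential -/

/-- **Crux + positivity clause at `v` ⟹ `PeriodicBEC` clause at `v`.** For an admissible `v`, if near-minimisers
along `L_N = (N/ρ)^{1/3}` have positive translation coherence (dilute, eventually in `N`, `δ` after `N`) then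
`LevyNegativeMoment` gives constant-mode condensation `condensateOccupation ≥ cN` of all near-minimisers at every
small density (c3's localised certificate fed with c2's grid-mean floor from the crux and the proved support
`GridAverageCondensate`). [folklore] -/
theorem periodicBEC_clause_of_levyNegativeMoment_of_coherencePos_clause
    (h2 : Summit.AtomisticToContinuum.BoseEinsteinCondensation.Theses.BECInfDivCoherence.LevyNegativeMoment)
    {v : ℝ → ℝ≥0∞} (hv : IsRepulsiveFiniteRange v)
    (hpos : ∃ ρ₀ : ℝ, 0 < ρ₀ ∧
      ∀ ρ : ℝ, 0 < ρ → ρ < ρ₀ → ∀ᶠ N : ℕ in atTop, ∃ δ : ℝ≥0∞, 0 < δ ∧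
        ∀ Ψ : PeriodicTrialState N (sideLength ρ N),
          periodicEnergy v Ψ ≤ periodicGroundStateEnergy v N (sideLength ρ N) + δ → ∀ i : Fin N,
            ∀ r, 0 < (∫ X in cellN N (sideLength ρ N),
              conj (Ψ.ψ (Function.update X i (X i + r))) * Ψ.ψ X).re) :
    ∃ ρ₀ : ℝ, 0 < ρ₀ ∧ ∀ ρ : ℝ, 0 < ρ → ρ < ρ₀ →
      ∃ c : ℝ, 0 < c ∧ ∀ᶠ N : ℕ in atTop, ∃ δ : ℝ≥0∞, 0 < δ ∧
        ∀ Ψ : PeriodicTrialState N (sideLength ρ N),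
          periodicEnergy v Ψ ≤ periodicGroundStateEnergy v N (sideLength ρ N) + δ →
            ENNReal.ofReal (c * N) ≤ condensateOccupation N (sideLength ρ N) Ψ.ψ :=
  periodicBEC_clause_of_gridMeanLog_of_coherencePos hv hpos (gridMeanLog_of_levyNegativeMoment h2 v hv)
    gridAverageCondensate_proof

/-- **Stub + positivity clause at `v` ⟹ `PeriodicBEC` clause at `v`**: the same with the registered stub
`stub_logClusterL1` of line `registered` (inline, verbatim its registered signature) in place of the crux
(`gridMeanLog_of_logClusterL1`). [folklore] -/
theorem periodicBEC_clause_of_logClusterL1_of_coherencePos_clause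
    (h1 : ∀ v : ℝ → ENNReal, Literature.MathematicalPhysics.QuantumManyBody.BoseGas.IsRepulsiveFiniteRange v → ∀ η : ℝ, 0 < η → ∃ C : ℝ, ∃ ρ₀ : ℝ, 0 < ρ₀ ∧ ∀ ρ : ℝ, 0 < ρ → ρ < ρ₀ → ∀ᶠ N : ℕ in Filter.atTop, ∃ δ : ENNReal, 0 < δ ∧ ∀ Ψ : Literature.MathematicalPhysics.QuantumManyBody.BoseGas.PeriodicTrialState N (Literature.MathematicalPhysics.QuantumManyBody.BoseGas.sideLength ρ N), Literature.MathematicalPhysics.QuantumManyBody.BoseGas.periodicEnergy v Ψ ≤ Literature.MathematicalPhysics.QuantumManyBody.BoseGas.periodicGroundStateEnergy v N (Literature.MathematicalPhysics.QuantumManyBody.BoseGas.sideLength ρ N) + δ → ∀ i : Fin N, let L : ℝ := Literature.MathematicalPhysics.QuantumManyBody.BoseGas.sideLength ρ N; let m : ℕ := ⌊L / η⌋₊; let G : EuclideanSpace ℝ (Fin 3) → ℝ := fun r => (∫ X in Literature.MathematicalPhysics.QuantumManyBody.BoseGas.cellN N L, conj (Ψ.ψ (Function.update X i (X i + r))) *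 Ψ.ψ X).re; ∃ c : ℝ, (∑ j : Fin 3 → Fin m, |Real.log (G (Literature.MathematicalPhysics.QuantumManyBody.BoseGas.latticeVec (L / m) (fun k => ((j k : ℕ) : ℤ)))) - c| * ((L / m) / (1 + ∑ k, ((min (j k : ℕ) (m - (j k : ℕ)) : ℕ) : ℝ) ^ 2))) ≤ C)
    {v : ℝ → ℝ≥0∞} (hv : IsRepulsiveFiniteRange v)
    (hpos : ∃ ρ₀ : ℝ, 0 < ρ₀ ∧
      ∀ ρ : ℝ, 0 < ρ → ρ < ρ₀ → ∀ᶠ N : ℕ in atTop, ∃ δ : ℝ≥0∞, 0 < δ ∧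
        ∀ Ψ : PeriodicTrialState N (sideLength ρ N),
          periodicEnergy v Ψ ≤ periodicGroundStateEnergy v N (sideLength ρ N) + δ → ∀ i : Fin N,
            ∀ r, 0 < (∫ X in cellN N (sideLength ρ N),
              conj (Ψ.ψ (Function.update X i (X i + r))) * Ψ.ψ X).re) :
    ∃ ρ₀ : ℝ, 0 < ρ₀ ∧ ∀ ρ : ℝ, 0 < ρ → ρ < ρ₀ →
      ∃ c : ℝ, 0 < c ∧ ∀ᶠ N : ℕ in atTop, ∃ δ : ℝ≥0∞, 0 < δ ∧
        ∀ Ψ : PeriodicTrialState N (sideLength ρ N),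
          periodicEnergy v Ψ ≤ periodicGroundStateEnergy v N (sideLength ρ N) + δ →
            ENNReal.ofReal (c * N) ≤ condensateOccupation N (sideLength ρ N) Ψ.ψ :=
  periodicBEC_clause_of_gridMeanLog_of_coherencePos hv hpos (gridMeanLog_of_logClusterL1 h1 v hv)
    gridAverageCondensate_proof

/-! ### Integrable profiles (unconditional) -/

/-- **`LevyNegativeMoment` alone yields the `PeriodicBEC` clause of every INTEGRABLE admissible potential.**
If the crux holds then for every repulsive finite-range measurable `v` with `∫_{ℝ³} v(|x|) dx < ∞` (bounded soft
spheres, integrable singular cores, …) there is `ρ₀ > 0` such that for `0 < ρ < ρ₀` some `c > 0` bounds the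
constant-mode occupation of all near-minimisers on the torus from below, `condensateOccupation ≥ cN`, for all
large `N` — verbatim the clause of `BECPeriodicReduction.PeriodicBEC` at `v`.  Positivity input: the 9114 line's
`stub_coherencePos_integrable` (simplicity of the max-form ground state, clustering from the Ky Fan gap).
[folklore] -/
theorem periodicBEC_clause_of_levyNegativeMoment_integrable
    (h2 : Summit.AtomisticToContinuum.BoseEinsteinCondensation.Theses.BECInfDivCoherence.LevyNegativeMoment)
    {v : ℝ → ℝ≥0∞} (hv : IsRepulsiveFiniteRange v) (hint : (∫⁻ x : Space, v ‖x‖) ≠ ⊤) :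
    ∃ ρ₀ : ℝ, 0 < ρ₀ ∧ ∀ ρ : ℝ, 0 < ρ → ρ < ρ₀ →
      ∃ c : ℝ, 0 < c ∧ ∀ᶠ N : ℕ in atTop, ∃ δ : ℝ≥0∞, 0 < δ ∧
        ∀ Ψ : PeriodicTrialState N (sideLength ρ N),
          periodicEnergy v Ψ ≤ periodicGroundStateEnergy v N (sideLength ρ N) + δ →
            ENNReal.ofReal (c * N) ≤ condensateOccupation N (sideLength ρ N) Ψ.ψ :=
  periodicBEC_clause_of_levyNegativeMoment_of_coherencePos_clause h2 hv
    (stub_coherencePos_integrable v hv hint)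

/-- **The registered stub alone yields the `PeriodicBEC` clause of every INTEGRABLE admissible potential.**
[folklore] -/
theorem periodicBEC_clause_of_logClusterL1_integrable
    (h1 : ∀ v : ℝ → ENNReal, Literature.MathematicalPhysics.QuantumManyBody.BoseGas.IsRepulsiveFiniteRange v → ∀ η : ℝ, 0 < η → ∃ C : ℝ, ∃ ρ₀ : ℝ, 0 < ρ₀ ∧ ∀ ρ : ℝ, 0 < ρ → ρ < ρ₀ → ∀ᶠ N : ℕ in Filter.atTop, ∃ δ : ENNReal, 0 < δ ∧ ∀ Ψ : Literature.MathematicalPhysics.QuantumManyBody.BoseGas.PeriodicTrialState N (Literature.MathematicalPhysics.QuantumManyBody.BoseGas.sideLength ρ N), Literature.MathematicalPhysics.QuantumManyBody.BoseGas.periodicEnergy v Ψ ≤ Literature.MathematicalPhysics.QuantumManyBody.BoseGas.periodicGroundStateEnergy v N (Literature.MathematicalPhysics.QuantumManyBody.BoseGas.sideLength ρ N) + δ → ∀ i : Fin N, let L : ℝ := Literature.MathematicalPhysics.QuantumManyBody.BoseGas.sideLength ρ N; let m : ℕ := ⌊L / η⌋₊; let G : EuclideanSpace ℝ (Fin 3)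 → ℝ := fun r => (∫ X in Literature.MathematicalPhysics.QuantumManyBody.BoseGas.cellN N L, conj (Ψ.ψ (Function.update X i (X i + r))) * Ψ.ψ X).re; ∃ c : ℝ, (∑ j : Fin 3 → Fin m, |Real.log (G (Literature.MathematicalPhysics.QuantumManyBody.BoseGas.latticeVec (L / m) (fun k => ((j k : ℕ) : ℤ)))) - c| * ((L / m) / (1 + ∑ k, ((min (j k : ℕ) (m - (j k : ℕ)) : ℕ) : ℝ) ^ 2))) ≤ C)
    {v : ℝ → ℝ≥0∞} (hv : IsRepulsiveFiniteRange v) (hint : (∫⁻ x : Space, v ‖x‖) ≠ ⊤) :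
    ∃ ρ₀ : ℝ, 0 < ρ₀ ∧ ∀ ρ : ℝ, 0 < ρ → ρ < ρ₀ →
      ∃ c : ℝ, 0 < c ∧ ∀ᶠ N : ℕ in atTop, ∃ δ : ℝ≥0∞, 0 < δ ∧
        ∀ Ψ : PeriodicTrialState N (sideLength ρ N),
          periodicEnergy v Ψ ≤ periodicGroundStateEnergy v N (sideLength ρ N) + δ →
            ENNReal.ofReal (c * N) ≤ condensateOccupation N (sideLength ρ N) Ψ.ψ :=
  periodicBEC_clause_of_logClusterL1_of_coherencePos_clause h1 hv (stub_coherencePos_integrable v hv hint)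

/-! ### Profiles locally bounded on `(0,∞)` (unconditional; bounded and non-integrable soft cores) -/

/-- **`LevyNegativeMoment` alone yields the `PeriodicBEC` clause of every admissible potential that is locally
bounded on `(0,∞)`** (`∀ δ > 0 ∃ M < ∞, v ≤ M` on `(δ,∞)`: every bounded potential, and every soft core however
singular at the origin, integrable or not).  Positivity input: the 9114 line's
`CoherencePosHC.coherencePos_of_locallyBounded` (Faris–Simon positivity of the max-form ground state on the whole
torus, simplicity, Ruelle finiteness of `E₀`). [folklore] -/
theorem periodicBEC_clause_of_levyNegativeMoment_locallyBounded
    (h2 : Summit.AtomisticToContinuum.BoseEinsteinCondensation.Theses.BECInfDivCoherence.LevyNegativeMoment)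
    {v : ℝ → ℝ≥0∞} (hv : IsRepulsiveFiniteRange v)
    (hlb : ∀ δ : ℝ, 0 < δ → ∃ M : ℝ≥0∞, M ≠ ⊤ ∧ ∀ r : ℝ, δ < r → v r ≤ M) :
    ∃ ρ₀ : ℝ, 0 < ρ₀ ∧ ∀ ρ : ℝ, 0 < ρ → ρ < ρ₀ →
      ∃ c : ℝ, 0 < c ∧ ∀ᶠ N : ℕ in atTop, ∃ δ : ℝ≥0∞, 0 < δ ∧
        ∀ Ψ : PeriodicTrialState N (sideLength ρ N),
          periodicEnergy v Ψ ≤ periodicGroundStateEnergy v N (sideLength ρ N) + δ →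
            ENNReal.ofReal (c * N) ≤ condensateOccupation N (sideLength ρ N) Ψ.ψ :=
  periodicBEC_clause_of_levyNegativeMoment_of_coherencePos_clause h2 hv
    (CoherencePosHC.coherencePos_of_locallyBounded v hv hlb)

/-- **The registered stub alone yields the `PeriodicBEC` clause of every admissible potential locally bounded
on `(0,∞)`.** [folklore] -/
theorem periodicBEC_clause_of_logClusterL1_locallyBounded
    (h1 : ∀ v : ℝ → ENNReal, Literature.MathematicalPhysics.QuantumManyBody.BoseGas.IsRepulsiveFiniteRange v → ∀ η : ℝ, 0 < η → ∃ C : ℝ, ∃ ρ₀ : ℝ, 0 < ρ₀ ∧ ∀ ρ : ℝ, 0 < ρ → ρ < ρ₀ → ∀ᶠ N : ℕ in Filter.atTop, ∃ δ : ENNReal, 0 < δ ∧ ∀ Ψ : Literature.MathematicalPhysics.QuantumManyBody.BoseGas.PeriodicTrialState N (Literature.MathematicalPhysics.QuantumManyBody.BoseGas.sideLength ρ N), Literature.MathematicalPhysics.QuantumManyBody.BoseGas.periodicEnergy v Ψ ≤ Literature.MathematicalPhysics.QuantumManyBody.BoseGas.periodicGroundStateEnergy v N (Literature.MathematicalPhysics.QuantumManyBody.BoseGas.sideLength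 ρ N) + δ → ∀ i : Fin N, let L : ℝ := Literature.MathematicalPhysics.QuantumManyBody.BoseGas.sideLength ρ N; let m : ℕ := ⌊L / η⌋₊; let G : EuclideanSpace ℝ (Fin 3) → ℝ := fun r => (∫ X in Literature.MathematicalPhysics.QuantumManyBody.BoseGas.cellN N L, conj (Ψ.ψ (Function.update X i (X i + r))) * Ψ.ψ X).re; ∃ c : ℝ, (∑ j : Fin 3 → Fin m, |Real.log (G (Literature.MathematicalPhysics.QuantumManyBody.BoseGas.latticeVec (L / m) (fun k => ((j k : ℕ) : ℤ)))) - c| * ((L / m) / (1 + ∑ k, ((min (j k : ℕ) (m - (j k : ℕ)) : ℕ) : ℝ) ^ 2))) ≤ C)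
    {v : ℝ → ℝ≥0∞} (hv : IsRepulsiveFiniteRange v)
    (hlb : ∀ δ : ℝ, 0 < δ → ∃ M : ℝ≥0∞, M ≠ ⊤ ∧ ∀ r : ℝ, δ < r → v r ≤ M) :
    ∃ ρ₀ : ℝ, 0 < ρ₀ ∧ ∀ ρ : ℝ, 0 < ρ → ρ < ρ₀ →
      ∃ c : ℝ, 0 < c ∧ ∀ᶠ N : ℕ in atTop, ∃ δ : ℝ≥0∞, 0 < δ ∧
        ∀ Ψ : PeriodicTrialState N (sideLength ρ N),
          periodicEnergy v Ψ ≤ periodicGroundStateEnergy v N (sideLength ρ N) + δ →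
            ENNReal.ofReal (c * N) ≤ condensateOccupation N (sideLength ρ N) Ψ.ψ :=
  periodicBEC_clause_of_logClusterL1_of_coherencePos_clause h1 hv
    (CoherencePosHC.coherencePos_of_locallyBounded v hv hlb)

/-! ### Hard cores, modulo Lemma G -/

/-- **`LevyNegativeMoment` yields the `PeriodicBEC` clause of every HARD-CORE admissible potential, modulo
Lemma G.**  For `v = ⊤` on `[0,a)` (`a > 0`) with a tail bounded on every `(a',∞)`, `a' > a` (the hard-sphere gas
of LSSY Ch. 2, possibly with a bounded repulsive tail), the crux gives constant-mode condensation of all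
near-minimisers at every small density PROVIDED the dilute hard-sphere configuration space on the torus is
connected modulo relabelling (hypothesis `hG`, verbatim the 9114 line's registered `stub_lemmaGConnected`; open in
print).  Positivity input: `CoherencePosHC.coherencePos_of_hardCore`. [folklore] -/
theorem periodicBEC_clause_of_levyNegativeMoment_hardCore_of_lemmaG
    (h2 : Summit.AtomisticToContinuum.BoseEinsteinCondensation.Theses.BECInfDivCoherence.LevyNegativeMoment)
    (hG : ∀ b : ℝ, 0 < b → ∃ ρ₁ : ℝ, 0 < ρ₁ ∧ ∀ ρ : ℝ, 0 < ρ → ρ < ρ₁ → ∀ᶠ N : ℕ in atTop,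
      ∀ X ∈ {X : Config N | ∀ i j : Fin N, i ≠ j → ∀ n : Fin 3 → ℤ, b < ‖X i - X j - latticeVec (sideLength ρ N) n‖},
        ∀ Y ∈ {X : Config N | ∀ i j : Fin N, i ≠ j → ∀ n : Fin 3 → ℤ, b < ‖X i - X j - latticeVec (sideLength ρ N) n‖},
          ∃ σ : Equiv.Perm (Fin N),
            JoinedIn {X : Config N | ∀ i j : Fin N, i ≠ j → ∀ n : Fin 3 → ℤ,
              b < ‖X i - X j - latticeVec (sideLength ρ N) n‖} X (Y ∘ σ))
    {v : ℝ → ℝ≥0∞} (hv : IsRepulsiveFiniteRange v)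
    (hHC : ∃ a : ℝ, 0 < a ∧ (∀ r : ℝ, 0 ≤ r → r < a → v r = ⊤) ∧
      ∀ a' : ℝ, a < a' → ∃ M : ℝ≥0∞, M ≠ ⊤ ∧ ∀ r : ℝ, a' < r → v r ≤ M) :
    ∃ ρ₀ : ℝ, 0 < ρ₀ ∧ ∀ ρ : ℝ, 0 < ρ → ρ < ρ₀ →
      ∃ c : ℝ, 0 < c ∧ ∀ᶠ N : ℕ in atTop, ∃ δ : ℝ≥0∞, 0 < δ ∧
        ∀ Ψ : PeriodicTrialState N (sideLength ρ N),
          periodicEnergy v Ψ ≤ periodicGroundStateEnergy v N (sideLength ρ N) + δ →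
            ENNReal.ofReal (c * N) ≤ condensateOccupation N (sideLength ρ N) Ψ.ψ :=
  periodicBEC_clause_of_levyNegativeMoment_of_coherencePos_clause h2 hv
    (CoherencePosHC.coherencePos_of_hardCore hG v hv hHC)

/-! ### The summit conjunct's criterion, with the route's boundary transfer -/

/-- **Crux + `BoundaryTransferWeak` ⟹ `HasGroundStateBEC` at all small densities, integrable class.**  With the
route's own boundary-condition transfer (stmt-0827, whose hypothesis is exactly the `PeriodicBEC` clause of `v`),
`LevyNegativeMoment` gives the conjunct's Dirichlet, mode-free criterion for every integrable admissible `v`;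
the sister crux `GridInfDivCoherence` is not used. [folklore] -/
theorem hasGroundStateBEC_integrable_of_levyNegativeMoment_of_boundaryTransferWeak
    (h2 : Summit.AtomisticToContinuum.BoseEinsteinCondensation.Theses.BECInfDivCoherence.LevyNegativeMoment)
    (h6 : Summit.AtomisticToContinuum.BoseEinsteinCondensation.Theses.BECInfDivCoherence.BoundaryTransferWeak) :
    ∀ v : ℝ → ℝ≥0∞, IsRepulsiveFiniteRange v → (∫⁻ x : Space, v ‖x‖) ≠ ⊤ →
      ∃ ρ₀ : ℝ, 0 < ρ₀ ∧ ∀ ρ : ℝ, 0 < ρ → ρ < ρ₀ → HasGroundStateBEC v ρ :=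
  fun _ hv hint => h6 _ hv (periodicBEC_clause_of_levyNegativeMoment_integrable h2 hv hint)

/-- **Crux + `BoundaryTransferWeak` ⟹ `HasGroundStateBEC` at all small densities, locally bounded class**
(every bounded potential and every soft core): the sister crux is idle for the whole route there. [folklore] -/
theorem hasGroundStateBEC_locallyBounded_of_levyNegativeMoment_of_boundaryTransferWeak
    (h2 : Summit.AtomisticToContinuum.BoseEinsteinCondensation.Theses.BECInfDivCoherence.LevyNegativeMoment)
    (h6 : Summit.AtomisticToContinuum.BoseEinsteinCondensation.Theses.BECInfDivCoherence.BoundaryTransferWeak) :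
    ∀ v : ℝ → ℝ≥0∞, IsRepulsiveFiniteRange v →
      (∀ δ : ℝ, 0 < δ → ∃ M : ℝ≥0∞, M ≠ ⊤ ∧ ∀ r : ℝ, δ < r → v r ≤ M) →
      ∃ ρ₀ : ℝ, 0 < ρ₀ ∧ ∀ ρ : ℝ, 0 < ρ → ρ < ρ₀ → HasGroundStateBEC v ρ :=
  fun _ hv hlb => h6 _ hv (periodicBEC_clause_of_levyNegativeMoment_locallyBounded h2 hv hlb)

/-- **Crux + `BoundaryTransferWeak` + Lemma G ⟹ `HasGroundStateBEC` at all small densities for hard cores**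
(hard spheres with a bounded tail; `hG` = dilute hard-sphere connectivity, the 9114/11786/9467 residue).
[folklore] -/
theorem hasGroundStateBEC_hardCore_of_levyNegativeMoment_of_boundaryTransferWeak_of_lemmaG
    (h2 : Summit.AtomisticToContinuum.BoseEinsteinCondensation.Theses.BECInfDivCoherence.LevyNegativeMoment)
    (h6 : Summit.AtomisticToContinuum.BoseEinsteinCondensation.Theses.BECInfDivCoherence.BoundaryTransferWeak)
    (hG : ∀ b : ℝ, 0 < b → ∃ ρ₁ : ℝ, 0 < ρ₁ ∧ ∀ ρ : ℝ, 0 < ρ → ρ < ρ₁ → ∀ᶠ N : ℕ in atTop,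
      ∀ X ∈ {X : Config N | ∀ i j : Fin N, i ≠ j → ∀ n : Fin 3 → ℤ, b < ‖X i - X j - latticeVec (sideLength ρ N) n‖},
        ∀ Y ∈ {X : Config N | ∀ i j : Fin N, i ≠ j → ∀ n : Fin 3 → ℤ, b < ‖X i - X j - latticeVec (sideLength ρ N) n‖},
          ∃ σ : Equiv.Perm (Fin N),
            JoinedIn {X : Config N | ∀ i j : Fin N, i ≠ j → ∀ n : Fin 3 → ℤ,
              b < ‖X i - X j - latticeVec (sideLength ρ N) n‖} X (Y ∘ σ)) :
    ∀ v : ℝ → ℝ≥0∞, IsRepulsiveFiniteRange v →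
      (∃ a : ℝ, 0 < a ∧ (∀ r : ℝ, 0 ≤ r → r < a → v r = ⊤) ∧
        ∀ a' : ℝ, a < a' → ∃ M : ℝ≥0∞, M ≠ ⊤ ∧ ∀ r : ℝ, a' < r → v r ≤ M) →
      ∃ ρ₀ : ℝ, 0 < ρ₀ ∧ ∀ ρ : ℝ, 0 < ρ → ρ < ρ₀ → HasGroundStateBEC v ρ :=
  fun _ hv hHC => h6 _ hv (periodicBEC_clause_of_levyNegativeMoment_hardCore_of_lemmaG h2 hG hv hHC)

end Summit.AtomisticToContinuum.BoseEinsteinCondensation.Theorems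

end
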